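import Literature.Computability.Cryptography.CsidhActionFreeProofs
import Literature.Computability.Cryptography.CsidhActionHorizontalProofs
import Literature.Computability.Cryptography.CsidhActionNormalFormProofs
import HarnessLib

/-!
# The CSIDH class-group action is transitive on an isogeny class (clause (3) from Tate's theorem)

Sibling *proofs* file (theorems only, D-0014/D-0026) of
`Literature.Computability.Cryptography.CsidhAction`. Main result: `exists_label_of_isogeny` — for
`p ≡ 3 (mod 8)`, `p ≥ 5` and valid `A₀, A₁`, **every `𝔽_p`-isogeny `ψ : E_{A₀} → E_{A₁}` is, up
to `𝔽_p`-isomorphism of the codomain, the isogeny with kernel `E_{A₀}[𝔞_f]` of a unique label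
`f`**, i.e. `act p f A₀ = A₁` (Castryck–Lange–Martindale–Panny–Renes, *CSIDH*, ASIACRYPT 2018,
§3 Thm. 7, "transitively", after Waterhouse 1969 Thm. 4.5 / Schoof 1987). Consequently the named
fact `csidh_classGroupAction` follows from the existence of one `𝔽_p`-isogeny between any two valid
curves (`csidh_classGroupAction_of_isogenous`), which is Tate's isogeny theorem in point-count
form (`#E_{A₀}(𝔽_p) = p + 1 = #E_{A₁}(𝔽_p)`; the tree's unproved
`Literature.AlgebraicGeometry.Motives.isIsogenous_iff_card_point_eq`).

Proof of `exists_label_of_isogeny`, by induction on `#ker ψ` (the kernel `H` is a finite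
`π`-stable subgroup of `E_{A₀}(𝔽̄_p)`, and `p ∤ #H` since `E[p] = O`):
* `H = O`: `A₁ = A₀` (`exists_label_of_ker_eq_bot`).
* an odd prime `ℓ ∣ #H`: `S = H ∩ E[ℓ]` has order `ℓ²` — then `E[ℓ] ⊆ H` and `ψ = λ ∘ [ℓ]`
  (`exists_factor_nsmul`) — or order `ℓ`; then `S` is a `π`-stable line, `π = c` on it, and
  `S = E[ℓ] ∩ ker(π - c) = E_{A₀}[𝔞_{f₁}]`, `f₁ = (ℓ, 2c, (c² + p)/ℓ)` (eigenspace bound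
  `natCard_torsion_eigen_le`); `ψ` factors through the valid curve `E_{act f A₀}`
  (`exists_factor_odd`) and induction plus `act_comp'` conclude.
* `#H = 2^e`, `e ≥ 1`, `E[2] ⊄ H`: `H ∩ E[2]` has order `2`, so `H` is cyclic (socle bound),
  `H = ⟨Q⟩`, `πQ = uQ`, `2^e ∣ u² + p` with `u` odd, whence `e ≤ 2` (`u² + p ≡ 4 (mod 8)`).
  If `e = 2`, `H = E[4] ∩ ker(π - u) = E_{A₀}[𝔞_{(4, 2u, (p+1)/4)}]`, `u = ±1`, and
  `exists_label_of_ker_eq_idealKernel_four` applies. If `e = 1`, `H = {O, T}` with `T` the rational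
  `2`-torsion point; the rational point `Q₄` of order `4` (`2Q₄ = T`) and a non-rational
  `2`-torsion point `T₁` (`πT₁ = T₁ + T`) map to two distinct non-zero rational `2`-torsion points
  of `E_{A₁}`, impossible on the floor (`no_root_of_isCoeff`): a valid curve has exactly one.

## References

* [CastryckEtAl2018] W. Castryck, T. Lange, C. Martindale, L. Panny, J. Renes, *CSIDH*,
  ASIACRYPT 2018, §3 Thm. 7, §4, §5 Prop. 8.
* [Waterhouse1969] W. C. Waterhouse, *Abelian varieties over finite fields*, Ann. Sci. ÉNS (4) 2
  (1969), Thm. 4.5.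

## Design

`noncomputable section`, `open scoped Classical`; theorems only, no definitions, no new named
facts; `IsDomain (ℤ√(-p))` as a local instance (`isDomain_zsqrtd_neg`).
-/

noncomputable section

open scoped Classical

namespace Literature.Computability.Cryptography.Csidh

open Literature.NumberTheory.QuadraticFields.Quadratic
open Literature.NumberTheory.QuadraticFields.Quadratic.BinQF
open WeierstrassCurve

attribute [local instance] isDomain_zsqrtd_neg

universe u

variable {p : ℕ} [Fact p.Prime]

/-! ### Rational `2`-torsion on a valid curve -/

omit [Fact p.Prime] in
/-- `2 · ι(P) = O` forces `P + P = O` (any field). [folklore] -/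
theorem add_self_eq_zero_of_toGeomPoints {K : Type u} [Field K] (W : WeierstrassCurve K)
    (P : W.toAffine.Point) (h : (2 : ℤ) • W.toGeomPoints P = 0) : P + P = 0 := by
  rw [two_smul, ← map_add] at h
  exact W.toGeomPoints_injective (h.trans (map_zero _).symm)

/-- **A valid curve has at most one non-zero rational `2`-torsion point**: two non-zero
`π`-fixed points of `E_A(𝔽̄_p)` killed by `2` coincide (both are `(0, 0)`: a rational point `P`
with `P + P = O` is `(x, 0)` with `x(x² + Ax + 1) = 0`, and `x² + Ax + 1` has no root in `𝔽_p`
on the floor). [cite: CastryckEtAl2018, §5 Prop. 8 (proof)] -/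
theorem eq_of_two_torsion_rational (hp8 : p % 8 = 3) {A : ZMod p} (hA : IsCoeff p A)
    {X Y : (curve p A).geomPoints} (hX : X ≠ 0) (h2X : (2 : ℤ) • X = 0) (hπX : frob p • X = X)
    (hY : Y ≠ 0) (h2Y : (2 : ℤ) • Y = 0) (hπY : frob p • Y = Y) : X = Y := by
  haveI := isElliptic_of_isCoeff hp8 hA
  haveI : NeZero p := ⟨(Fact.out : p.Prime).ne_zero⟩
  have hfrob : ∀ x : AlgebraicClosure (ZMod p), frob p • x = x ^ Nat.card (ZMod p) :=
    frob_smul_eq_pow_card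
  -- both are images of rational points `(0, 0)`
  have key : ∀ Z : (curve p A).geomPoints, Z ≠ 0 → (2 : ℤ) • Z = 0 → frob p • Z = Z →
      ∃ h, Z = (curve p A).toGeomPoints (Affine.Point.some 0 0 h) := by
    intro Z hZ h2Z hπZ
    obtain ⟨P, rfl⟩ := (smul_eq_self_iff_mem_range_toGeomPoints hfrob Z).mp hπZ
    have hP0 : P ≠ 0 := fun h ↦ hZ (by rw [h, map_zero])
    have hPP : P + P = 0 := by
      have := add_self_eq_zero_of_toGeomPoints (curve p A) P h2Z
      convert this
    obtain ⟨x, hx, rfl⟩ := exists_eq_some_zero_of_add_self_eq_zero hp8 (V := curve p A) rfl rfl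
      hP0 hPP
    have hx0 : x = 0 := by
      have he : (curve p A).toAffine.Equation x 0 := hx.1
      rw [equation_zero_iff] at he
      rcases mul_eq_zero.1 he with h | h
      · exact h
      · exact absurd h (no_root_of_isCoeff hp8 hA x)
    subst hx0
    exact ⟨hx, rfl⟩
  obtain ⟨hX', eX⟩ := key X hX h2X hπX
  obtain ⟨hY', eY⟩ := key Y hY h2Y hπY
  rw [eX, eY]

/-- **No `𝔽_p`-isogeny between valid curves has kernel `{O, T}` with `T` rational.** With `Q₄`
rational of order `4` (`2Q₄ = T`) and `T₁ ∈ E[2]` non-rational (`πT₁ = T₁ + T`), the points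
`ψ(Q₄)` and `ψ(T₁)` are distinct non-zero rational `2`-torsion points of `E_{A₁}`, contradicting
`eq_of_two_torsion_rational` (the codomain would lie on the surface).
[cite: CastryckEtAl2018, §5 Prop. 8; §3 (horizontal isogenies)] -/
theorem false_of_ker_eq_pair (hp8 : p % 8 = 3) {A₀ A₁ : ZMod p} (hA₀ : IsCoeff p A₀)
    (hA₁ : IsCoeff p A₁) (ψ : (curve p A₀).Isogeny (curve p A₁)) {T : (curve p A₀).geomPoints}
    (hT0 : T ≠ 0) (h2T : (2 : ℤ) • T = 0) (hπT : frob p • T = T)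
    (hker : ∀ X, ψ X = 0 ↔ X = 0 ∨ X = T) : False := by
  haveI := isElliptic_of_isCoeff hp8 hA₀
  haveI := isElliptic_of_isCoeff hp8 hA₁
  -- a rational point of order `4`, with `2 Q = T`
  obtain ⟨P₄, hP₄⟩ := exists_point_addOrderOf_eq_four hp8 hA₀
  set Q : (curve p A₀).geomPoints := (curve p A₀).toGeomPoints P₄ with hQ
  have hQord : addOrderOf Q = 4 := by
    rw [hQ, addOrderOf_toGeomPoints]
    convert hP₄
  have h4Q : (4 : ℤ) • Q = 0 := by
    rw [← addOrderOf_dvd_iff_zsmul_eq_zero, hQord]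
    norm_num
  have h2Q : (2 : ℤ) • Q ≠ 0 := by
    intro h
    have := addOrderOf_dvd_iff_zsmul_eq_zero.2 h
    rw [hQord] at this
    norm_num at this
  have hπQ : frob p • Q = Q := by rw [hQ, smul_toGeomPoints]
  have h2QT : (2 : ℤ) • Q = T := by
    refine eq_of_two_torsion_rational hp8 hA₀ h2Q ?_ ?_ hT0 h2T hπT
    · rw [smul_smul]; exact h4Q
    · rw [frob_smul_zsmul, hπQ]
  -- a non-rational `2`-torsion point, with `π T₁ = T₁ + T`
  obtain ⟨T₁, h2T₁, hπT₁⟩ := exists_two_torsion_smul_ne hp8 hA₀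
  have hnegT₁ : -T₁ = T₁ := by
    rw [neg_eq_iff_add_eq_zero, ← two_smul ℤ, h2T₁]
  have hpT₁ : (p : ℤ) • T₁ = T₁ := by
    obtain ⟨m, hm⟩ : Odd (p : ℤ) := by
      have : Odd p := (Fact.out : p.Prime).odd_of_ne_two (by omega)
      exact_mod_cast this
    rw [hm, add_smul, one_smul, mul_comm, mul_smul, h2T₁, smul_zero, zero_add]
  have hR : frob p • T₁ + T₁ = T := by
    refine eq_of_two_torsion_rational hp8 hA₀ ?_ ?_ ?_ hT0 h2T hπT
    · intro h
      apply hπT₁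
      rw [eq_neg_of_add_eq_zero_left h, hnegT₁]
    · rw [smul_add, ← frob_smul_zsmul, h2T₁, smul_zero, zero_add]
    · rw [smul_add, frob_smul_frob_smul hp8 hA₀, hpT₁, hnegT₁, add_comm]
  have hπT₁' : frob p • T₁ = T₁ + T := by rw [← hR, add_comm (frob p • T₁), ← add_assoc, ← two_smul ℤ, h2T₁, zero_add]
  -- their images are distinct non-zero rational `2`-torsion points of `E_{A₁}`
  have hQ0 : ψ Q ≠ 0 := by
    intro h
    rcases (hker Q).1 h with h' | h'
    · apply h2Q; rw [h', smul_zero]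
    · apply h2Q; rw [h', h2T]
  have hT₁0 : ψ T₁ ≠ 0 := by
    intro h
    rcases (hker T₁).1 h with h' | h'
    · apply hπT₁; rw [h', smul_zero]
    · apply hπT₁; rw [h', hπT]
  refine absurd (eq_of_two_torsion_rational hp8 hA₁ hQ0 ?_ ?_ hT₁0 ?_ ?_) ?_
  · rw [← map_zsmul, h2QT, (hker T).2 (Or.inr rfl)]
  · rw [← Isogeny.map_smul, hπQ]
  · rw [← map_zsmul, h2T₁, map_zero]
  · rw [← Isogeny.map_smul, hπT₁', map_add, (hker T).2 (Or.inr rfl), add_zero]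
  · intro h
    have h' : ψ (Q - T₁) = 0 := by rw [map_sub, h, sub_self]
    rcases (hker _).1 h' with h'' | h''
    · apply h2Q
      rw [sub_eq_zero.1 h'', h2T₁]
    · apply h2Q
      rw [sub_eq_iff_eq_add.1 h'', smul_add, h2T, h2T₁, add_zero]

/-! ### `π`-stable lines -/

/-- **A `π`-stable subgroup of `E[ℓ]` of order `ℓ` (prime `ℓ ≠ p`) is `E_{A}[𝔞_{f₁}]`** for the
form `f₁ = (ℓ, 2c, (c² + p)/ℓ)`, where `π = c` on it: it is cyclic, `π` acts by a scalar `c` with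
`c² ≡ -p (mod ℓ)`, `ℓ ∤ c`, and the eigenspace `E[ℓ] ∩ ker(π - c)` has at most `ℓ` points.
[cite: CastryckEtAl2018, §3 (the action of `cl(𝒪)`), §4] -/
theorem exists_eq_idealKernel_of_card_eq_prime (hp8 : p % 8 = 3) {A : ZMod p} (hA : IsCoeff p A)
    {ℓ : ℕ} (hℓ : ℓ.Prime) (S : AddSubgroup (curve p A).geomPoints)
    (hSle : S ≤ geomTorsion (curve p A) ℓ) (hSπ : ∀ T ∈ S, frob p • T ∈ S)
    (hcard : Nat.card S = ℓ) :
    ∃ c : ℤ, (ℓ : ℤ) ∣ c ^ 2 + p ∧ ¬ (ℓ : ℤ) ∣ c ∧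
      S = idealKernel p ⟨ℓ, 2 * c, (c ^ 2 + p) / ℓ⟩ A := by
  haveI := isElliptic_of_isCoeff hp8 hA
  haveI : Fact ℓ.Prime := ⟨hℓ⟩
  haveI : Finite S := Nat.finite_of_card_ne_zero (by rw [hcard]; exact hℓ.ne_zero)
  -- a generator `T`
  haveI : Nontrivial S := Finite.one_lt_card_iff_nontrivial.1 (by rw [hcard]; exact hℓ.one_lt)
  obtain ⟨⟨T, hTS⟩, hT0⟩ := exists_ne (0 : S)
  have hT0' : T ≠ 0 := fun h ↦ hT0 (Subtype.ext h)
  have hℓT : (ℓ : ℤ) • T = 0 := (Submodule.mem_torsionBy_iff _ _).1 (hSle hTS)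
  have hordT : addOrderOf T = ℓ :=
    addOrderOf_eq_prime (by rw [← natCast_zsmul]; exact hℓT) hT0'
  have hzm : AddSubgroup.zmultiples T = S := by
    refine AddSubgroup.eq_of_le_of_card_ge (AddSubgroup.zmultiples_le.2 hTS) ?_
    rw [hcard, Nat.card_zmultiples, hordT]
  -- `π T = c T`
  obtain ⟨c, hc⟩ : ∃ c : ℤ, c • T = frob p • T := by
    have := hSπ T hTS
    rw [← hzm, AddSubgroup.mem_zmultiples_iff] at this
    exact this
  have hccp : (c * c + p) • T = 0 := by
    have h1 := frob_smul_frob_smul hp8 hA T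
    rw [← hc, frob_smul_zsmul, ← hc, smul_smul] at h1
    rw [add_smul, h1, neg_add_cancel]
  have hcp : (ℓ : ℤ) ∣ c ^ 2 + p := by
    have : ((addOrderOf T : ℕ) : ℤ) ∣ c * c + p := addOrderOf_dvd_iff_zsmul_eq_zero.2 hccp
    rwa [hordT, ← sq] at this
  have hcndvd : ¬ (ℓ : ℤ) ∣ c := by
    rintro ⟨k, rfl⟩
    apply hT0'
    have : frob p • T = 0 := by rw [← hc, mul_comm, mul_smul, hℓT, smul_zero]
    exact (smul_eq_zero_iff_eq (frob p)).1 this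
  -- `S ⊆ E[𝔞_{f₁}]`, and `#E[𝔞_{f₁}] ≤ ℓ`
  set f₁ : BinQF := ⟨ℓ, 2 * c, (c ^ 2 + p) / ℓ⟩ with hf₁
  have hb : f₁.b / 2 = c := Int.mul_ediv_cancel_left _ two_ne_zero
  have hSle' : S ≤ idealKernel p f₁ A := by
    intro X hX
    rw [← hzm, AddSubgroup.mem_zmultiples_iff] at hX
    obtain ⟨k, rfl⟩ := hX
    rw [mem_idealKernel_iff, hb]
    constructor
    · show (ℓ : ℤ) • k • T = 0
      rw [smul_comm, hℓT, smul_zero]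
    · rw [frob_smul_zsmul, ← hc, smul_comm]
  haveI := finite_torsion_eigen hp8 hA hℓ.ne_zero c
  have hcardK : Nat.card (idealKernel p f₁ A) ≤ ℓ := by
    have e : Nat.card (idealKernel p f₁ A) = Nat.card {X : (curve p A).geomPoints //
        ((ℓ : ℕ) : ℤ) • X = 0 ∧ frob p • X = c • X} :=
      Nat.card_congr (Equiv.subtypeEquivRight fun X ↦ by rw [mem_idealKernel_iff, hb])
    rw [e]
    exact natCard_torsion_eigen_le hp8 hA hℓ.pos c
  haveI : Finite (idealKernel p f₁ A) :=
    (finite_idealKernel (f := f₁) (by show (ℓ : ℤ) ≠ 0; exact_mod_cast hℓ.ne_zero) A).to_subtype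
  exact ⟨c, hcp, hcndvd, AddSubgroup.eq_of_le_of_card_ge hSle' (by rw [hcard]; exact hcardK)⟩

/-! ### Kernels of `2`-power order -/

/-- **Kernels of order `2^e` avoiding `E[2]`.** If `#ker ψ = 2^e`, `e ≥ 1`, and `E[2] ⊄ ker ψ`,
then `ker ψ` is cyclic (`π`-stable, meeting `E[2]` in the rational point only), generated by `Q`
with `πQ = uQ`, `u` odd, `2^e ∣ u² + p`; so `e ≤ 2` for `p ≡ 3 (mod 8)`. The case `e = 1` is
excluded by `false_of_ker_eq_pair`, and for `e = 2` the kernel is `E[4] ∩ ker(π - u₀)`,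
`u₀ = ±1`, handled by `exists_label_of_ker_eq_idealKernel_four`.
[cite: CastryckEtAl2018, §3 Thm. 7, §4, §5 Prop. 8] -/
theorem exists_label_of_card_ker_eq_two_pow (hp8 : p % 8 = 3) (hp5 : 5 ≤ p) {A₀ A₁ : ZMod p}
    (hA₀ : IsCoeff p A₀) (hA₁ : IsCoeff p A₁) (ψ : (curve p A₀).Isogeny (curve p A₁)) {e : ℕ}
    (he : 0 < e) (hcard : Nat.card ψ.toAddMonoidHom.ker = 2 ^ e)
    (hnot : ¬ geomTorsion (curve p A₀) 2 ≤ ψ.toAddMonoidHom.ker) :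
    ∃ f : BinQF, IsLabel (-(p : ℤ)) f ∧ act p f A₀ = A₁ := by
  haveI := isElliptic_of_isCoeff hp8 hA₀
  haveI := isElliptic_of_isCoeff hp8 hA₁
  haveI : NeZero p := ⟨(Fact.out : p.Prime).ne_zero⟩
  have hp2 : ¬ p ∣ 2 := fun h ↦ by
    have := (Nat.prime_dvd_prime_iff_eq Fact.out Nat.prime_two).1 h
    omega
  -- `#(ker ψ ∩ E[2]) ≤ 2`
  have hcardE : Nat.card (geomTorsion (curve p A₀) 2) = 2 ^ 2 :=
    natCard_geomTorsion_prime hp8 hA₀ hp2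
  haveI : Finite (geomTorsion (curve p A₀) 2) :=
    Nat.finite_of_card_ne_zero (by rw [hcardE]; norm_num)
  set S := ψ.toAddMonoidHom.ker ⊓ geomTorsion (curve p A₀) 2 with hS
  have hSle : S ≤ geomTorsion (curve p A₀) 2 := inf_le_right
  haveI : Finite S := Finite.of_injective
    (fun s : S ↦ (⟨s.1, hSle s.2⟩ : geomTorsion (curve p A₀) 2))
    fun a b h ↦ Subtype.ext (by simpa using congrArg Subtype.val h)
  have hS2 : Nat.card S ≤ 2 := by
    have hdvd : Nat.card S ∣ 2 ^ 2 := hcardE ▸ AddSubgroup.card_dvd_of_le hSle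
    obtain ⟨i, hi, hci⟩ := (Nat.dvd_prime_pow Nat.prime_two).1 hdvd
    interval_cases i
    · rw [hci]; norm_num
    · rw [hci, pow_one]
    · exfalso
      apply hnot
      have : S = geomTorsion (curve p A₀) 2 :=
        AddSubgroup.eq_of_le_of_card_ge hSle (by rw [hcardE, hci])
      rw [← this]
      exact inf_le_left
  have hH2 : Nat.card {x : ψ.toAddMonoidHom.ker // ((2 : ℕ) : ℤ) • x = 0} ≤ 2 := by
    refine le_trans (Nat.card_le_card_of_injective
      (fun x : {x : ψ.toAddMonoidHom.ker // ((2 : ℕ) : ℤ) • x = 0} ↦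
        (⟨x.1.1, AddSubgroup.mem_inf.2 ⟨x.1.2,
          (Submodule.mem_torsionBy_iff _ _).2 (by exact_mod_cast x.2)⟩⟩ : S))
      fun x y h ↦ ?_) hS2
    simp only [Subtype.mk.injEq] at h
    exact Subtype.ext (Subtype.ext h)
  -- `ker ψ` is cyclic
  have hexp : AddMonoid.exponent ψ.toAddMonoidHom.ker = Nat.card ψ.toAddMonoidHom.ker := by
    refine Nat.le_antisymm (Nat.le_of_dvd Nat.card_pos AddGroup.exponent_dvd_nat_card) ?_
    refine natCard_le_of_card_torsion_le (AddMonoid.exponent ψ.toAddMonoidHom.ker)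
      (Nat.pos_of_ne_zero AddMonoid.exponent_ne_zero_of_finite) (fun x ↦ ?_) fun q hq hqd ↦ ?_
    · rw [natCast_zsmul]
      exact AddMonoid.exponent_nsmul_eq_zero x
    · have hq2 : q = 2 := by
        have h1 : q ∣ 2 ^ e := hcard ▸ hqd.trans AddGroup.exponent_dvd_nat_card
        exact (Nat.prime_dvd_prime_iff_eq hq Nat.prime_two).1 (hq.dvd_of_dvd_pow h1)
      subst hq2
      exact hH2
  haveI : IsAddCyclic ψ.toAddMonoidHom.ker := IsAddCyclic.of_exponent_eq_card hexp
  obtain ⟨Q, hQgen⟩ := IsAddCyclic.exists_generator (α := ψ.toAddMonoidHom.ker)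
  have hordQ : addOrderOf (Q : (curve p A₀).geomPoints) = 2 ^ e := by
    rw [AddSubgroup.addOrderOf_coe, addOrderOf_eq_card_of_forall_mem_zmultiples hQgen, hcard]
  have hmemQ : ∀ X : (curve p A₀).geomPoints, X ∈ ψ.toAddMonoidHom.ker →
      ∃ k : ℤ, k • (Q : (curve p A₀).geomPoints) = X := by
    intro X hX
    have := hQgen ⟨X, hX⟩
    rw [AddSubgroup.mem_zmultiples_iff] at this
    obtain ⟨k, hk⟩ := this
    exact ⟨k, by simpa using congrArg Subtype.val hk⟩
  -- `π Q = u Q`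
  have hπQmem : frob p • (Q : (curve p A₀).geomPoints) ∈ ψ.toAddMonoidHom.ker := by
    have hQ := Q.2
    rw [AddMonoidHom.mem_ker, Isogeny.coe_toAddMonoidHom] at hQ ⊢
    rw [Isogeny.map_smul, hQ, smul_zero]
  obtain ⟨u, hu⟩ := hmemQ _ hπQmem
  -- `2^e ∣ u² + p`, `u` odd, `e ≤ 2`
  have hdiv : ((2 ^ e : ℕ) : ℤ) ∣ u * u + p := by
    rw [← hordQ, addOrderOf_dvd_iff_zsmul_eq_zero]
    have h1 := frob_smul_frob_smul hp8 hA₀ (Q : (curve p A₀).geomPoints)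
    rw [← hu, frob_smul_zsmul, ← hu, smul_smul] at h1
    rw [add_smul, h1, neg_add_cancel]
  have hpodd : Odd (p : ℤ) := by exact_mod_cast (Fact.out : p.Prime).odd_of_ne_two (by omega)
  have h2e : (2 : ℤ) ∣ ((2 ^ e : ℕ) : ℤ) := by exact_mod_cast dvd_pow_self 2 he.ne'
  have heven : Even (u * u + p) := even_iff_two_dvd.2 (h2e.trans hdiv)
  have huodd : Odd u := by
    by_contra h
    rw [Int.not_odd_iff_even] at h
    exact (Int.not_even_iff_odd.2 hpodd) ((Int.even_add.1 heven).1 (h.mul_right u))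
  have he2 : e ≤ 2 := by
    by_contra h3
    have h8 : (8 : ℤ) ∣ ((2 ^ e : ℕ) : ℤ) := by
      have : 2 ^ 3 ∣ 2 ^ e := Nat.pow_dvd_pow 2 (by omega)
      exact_mod_cast this
    have h8' := h8.trans hdiv
    obtain ⟨w, hw⟩ := huodd
    obtain ⟨t, ht⟩ := Int.even_mul_succ_self w
    have hu2 : u * u = 4 * (w * (w + 1)) + 1 := by rw [hw]; ring
    rw [hu2, ht] at h8'
    omega
  have hker0 : ∀ X : (curve p A₀).geomPoints, X ∈ ψ.toAddMonoidHom.ker ↔ ψ X = 0 := fun X ↦ by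
    rw [AddMonoidHom.mem_ker, Isogeny.coe_toAddMonoidHom]
  interval_cases e
  · -- `e = 1`: `ker ψ = {O, T}` with `T` rational — impossible
    exfalso
    set T := (Q : (curve p A₀).geomPoints) with hT
    have h2T : (2 : ℤ) • T = 0 := by
      rw [← addOrderOf_dvd_iff_zsmul_eq_zero, hordQ]
      norm_num
    have hT0 : T ≠ 0 := by
      intro h
      have := hordQ
      rw [h, addOrderOf_zero] at this
      norm_num at this
    have hπT : frob p • T = T := by
      obtain ⟨w, hw⟩ := huodd
      rw [← hu, hw, add_smul, one_smul, mul_comm, mul_smul, h2T, smul_zero, zero_add]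
    refine false_of_ker_eq_pair hp8 hA₀ hA₁ ψ hT0 h2T hπT fun X ↦ ⟨fun hX ↦ ?_, ?_⟩
    · obtain ⟨k, hk⟩ := hmemQ X ((hker0 X).2 hX)
      rcases Int.even_or_odd k with ⟨j, rfl⟩ | ⟨j, rfl⟩
      · left
        rw [← hk, ← two_mul, mul_comm, mul_smul, h2T, smul_zero]
      · right
        rw [← hk, add_smul, one_smul, mul_comm, mul_smul, h2T, smul_zero, zero_add]
    · rintro (rfl | rfl)
      · exact map_zero _
      · exact (hker0 T).1 Q.2
  · -- `e = 2`: `ker ψ = E[4] ∩ ker(π - u₀)`, `u₀ = ±1`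
    obtain ⟨u₀, hu₀, hdvd4⟩ : ∃ u₀ : ℤ, (u₀ = 1 ∨ u₀ = -1) ∧ (4 : ℤ) ∣ u - u₀ := by
      obtain ⟨w, hw⟩ := huodd
      rcases Int.even_or_odd w with ⟨j, rfl⟩ | ⟨j, rfl⟩
      · exact ⟨1, Or.inl rfl, ⟨j, by rw [hw]; ring⟩⟩
      · exact ⟨-1, Or.inr rfl, ⟨j + 1, by rw [hw]; ring⟩⟩
    have h4Q : (4 : ℤ) • (Q : (curve p A₀).geomPoints) = 0 := by
      rw [← addOrderOf_dvd_iff_zsmul_eq_zero, hordQ]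
      norm_num
    have hπQ : frob p • (Q : (curve p A₀).geomPoints) = u₀ • (Q : (curve p A₀).geomPoints) := by
      obtain ⟨j, hj⟩ := hdvd4
      rw [← hu, show u = u₀ + 4 * j by linarith, add_smul, mul_comm, mul_smul, h4Q, smul_zero,
        add_zero]
    set f₄ : BinQF := ⟨4, 2 * u₀, ((p : ℤ) + 1) / 4⟩ with hf₄
    have hb : f₄.b / 2 = u₀ := Int.mul_ediv_cancel_left _ two_ne_zero
    have hHle : ψ.toAddMonoidHom.ker ≤ idealKernel p f₄ A₀ := by
      intro X hX
      obtain ⟨k, rfl⟩ := hmemQ X hX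
      rw [mem_idealKernel_iff, hb]
      constructor
      · show (4 : ℤ) • k • (Q : (curve p A₀).geomPoints) = 0
        rw [smul_comm, h4Q, smul_zero]
      · rw [frob_smul_zsmul, hπQ, smul_comm]
    haveI := finite_torsion_eigen hp8 hA₀ (N := 4) (by norm_num) u₀
    have hcardK : Nat.card (idealKernel p f₄ A₀) ≤ 4 := by
      have e4 : Nat.card (idealKernel p f₄ A₀) = Nat.card {X : (curve p A₀).geomPoints //
          ((4 : ℕ) : ℤ) • X = 0 ∧ frob p • X = u₀ • X} :=
        Nat.card_congr (Equiv.subtypeEquivRight fun X ↦ by rw [mem_idealKernel_iff, hb, Nat.cast_ofNat])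
      rw [e4]
      exact natCard_torsion_eigen_le hp8 hA₀ (N := 4) (by norm_num) u₀
    haveI : Finite (idealKernel p f₄ A₀) :=
      (finite_idealKernel (f := f₄) (by show (4 : ℤ) ≠ 0; norm_num) A₀).to_subtype
    have hHeq : ψ.toAddMonoidHom.ker = idealKernel p f₄ A₀ :=
      AddSubgroup.eq_of_le_of_card_ge hHle (by rw [hcard]; exact hcardK.trans_eq (by norm_num))
    exact exists_label_of_ker_eq_idealKernel_four hp8 hp5 hA₀ hA₁ ψ hu₀ hHeq

/-! ### Transitivity from an isogeny -/

/-- **Every `𝔽_p`-isogeny between valid curves is an `act`** (CSIDH Thm. 7, "transitively";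
Waterhouse Thm. 4.5): for `p ≡ 3 (mod 8)`, `p ≥ 5`, valid `A₀, A₁` and an `𝔽_p`-isogeny
`ψ : E_{A₀} → E_{A₁}` there is a label `f` with `act p f A₀ = A₁`. Induction on `#ker ψ`; see the
module docstring. [cite: CastryckEtAl2018, §3 Thm. 7; Waterhouse1969, Thm. 4.5] -/
theorem exists_label_of_isogeny (hp8 : p % 8 = 3) (hp5 : 5 ≤ p) :
    ∀ (n : ℕ) {A₀ A₁ : ZMod p}, IsCoeff p A₀ → IsCoeff p A₁ →
      ∀ ψ : (curve p A₀).Isogeny (curve p A₁), Nat.card ψ.toAddMonoidHom.ker = n →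
        ∃ f : BinQF, IsLabel (-(p : ℤ)) f ∧ act p f A₀ = A₁ := by
  intro n
  induction n using Nat.strong_induction_on with
  | _ n ih =>
  intro A₀ A₁ hA₀ hA₁ ψ hn
  haveI := isElliptic_of_isCoeff hp8 hA₀
  haveI := isElliptic_of_isCoeff hp8 hA₁
  haveI : NeZero p := ⟨(Fact.out : p.Prime).ne_zero⟩
  have hd : (-(p : ℤ)) < 0 := by have := hp5; omega
  have hnpos : 0 < n := by rw [← hn]; exact Nat.card_pos
  -- composing two steps
  have hcomp : ∀ {A' : ZMod p} {f f₂ : BinQF}, IsLabel (-(p : ℤ)) f → act p f A₀ = A' →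
      IsLabel (-(p : ℤ)) f₂ → act p f₂ A' = A₁ →
      ∃ g : BinQF, IsLabel (-(p : ℤ)) g ∧ act p g A₀ = A₁ := by
    intro A' f f₂ hf hfA hf₂ hf₂A
    exact ⟨comp (-(p : ℤ)) f₂ f, isLabel_comp cox_formClassGroup_holds hd _ _,
      by rw [act_comp' hp8 hp5 hf₂ hf hA₀, hfA, hf₂A]⟩
  by_cases hodd : ∃ ℓ : ℕ, ℓ.Prime ∧ ℓ ≠ 2 ∧ ℓ ∣ n
  · obtain ⟨ℓ, hℓ, hℓ2, hℓn⟩ := hodd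
    haveI : Fact ℓ.Prime := ⟨hℓ⟩
    -- an element of order `ℓ` in `ker ψ`, so `ℓ ≠ p`
    obtain ⟨⟨T, hTH⟩, hTord⟩ :=
      exists_prime_addOrderOf_dvd_card' (G := ψ.toAddMonoidHom.ker) ℓ (by rw [hn]; exact hℓn)
    have hTord' : addOrderOf T = ℓ := by
      rw [← hTord]
      exact AddSubgroup.addOrderOf_coe (⟨T, hTH⟩ : ψ.toAddMonoidHom.ker)
    have hT0 : T ≠ 0 := by
      intro h
      rw [h, addOrderOf_zero] at hTord'
      exact hℓ.one_lt.ne hTord'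
    have hℓT : (ℓ : ℤ) • T = 0 := by rw [natCast_zsmul, ← hTord', addOrderOf_nsmul_eq_zero]
    have hℓp : ℓ ≠ p := by
      intro h
      apply hT0
      have h1 : (p : ℤ) • T = 0 := by have := hℓT; rwa [h] at this
      exact eq_zero_of_p_zsmul hp8 hA₀ h1
    -- `S = ker ψ ∩ E[ℓ]`
    set S := ψ.toAddMonoidHom.ker ⊓ geomTorsion (curve p A₀) ℓ with hS
    have hSle : S ≤ geomTorsion (curve p A₀) ℓ := inf_le_right
    have hcardE : Nat.card (geomTorsion (curve p A₀) ℓ) = ℓ ^ 2 :=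
      natCard_geomTorsion_prime hp8 hA₀ (N := ℓ) fun h ↦
        hℓp ((Nat.prime_dvd_prime_iff_eq Fact.out hℓ).1 h).symm
    haveI : Finite (geomTorsion (curve p A₀) ℓ) :=
      Nat.finite_of_card_ne_zero (by rw [hcardE]; exact pow_ne_zero _ hℓ.ne_zero)
    haveI : Finite S := Finite.of_injective
      (fun s : S ↦ (⟨s.1, hSle s.2⟩ : geomTorsion (curve p A₀) ℓ))
      fun a b h ↦ Subtype.ext (by simpa using congrArg Subtype.val h)
    have hTS : T ∈ S := AddSubgroup.mem_inf.2 ⟨hTH, (Submodule.mem_torsionBy_iff _ _).2 hℓT⟩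
    have hdvd : Nat.card S ∣ ℓ ^ 2 := hcardE ▸ AddSubgroup.card_dvd_of_le hSle
    obtain ⟨i, hi, hci⟩ := (Nat.dvd_prime_pow hℓ).1 hdvd
    have hi1 : 1 ≤ i := by
      rcases Nat.eq_zero_or_pos i with rfl | h
      · exfalso
        rw [pow_zero] at hci
        haveI := (Nat.card_eq_one_iff_unique.1 hci).1
        exact hT0 (congrArg Subtype.val (Subsingleton.elim (⟨T, hTS⟩ : S) ⟨0, S.zero_mem⟩))
      · exact h
    interval_cases i
    · -- `#S = ℓ`: an odd horizontal step
      have hSπ : ∀ X ∈ S, frob p • X ∈ S := fun X hX ↦ by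
        refine AddSubgroup.mem_inf.2 ⟨?_, ?_⟩
        · have h1 := (AddSubgroup.mem_inf.1 hX).1
          rw [AddMonoidHom.mem_ker, Isogeny.coe_toAddMonoidHom] at h1 ⊢
          rw [Isogeny.map_smul, h1, smul_zero]
        · have h2 := (Submodule.mem_torsionBy_iff _ _).1 ((AddSubgroup.mem_inf.1 hX).2)
          exact (Submodule.mem_torsionBy_iff _ _).2 (by rw [← frob_smul_zsmul, h2, smul_zero])
      obtain ⟨c, hcdiv, hcndiv, hSeq⟩ :=
        exists_eq_idealKernel_of_card_eq_prime hp8 hA₀ hℓ S hSle hSπ (by rw [hci, pow_one])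
      have hf₁ := isPosPrim_of_prime (p := p) hℓ hℓ2 c hcdiv hcndiv
      have hle : idealKernel p ⟨ℓ, 2 * c, (c ^ 2 + p) / ℓ⟩ A₀ ≤ ψ.toAddMonoidHom.ker := by
        rw [← hSeq]
        exact inf_le_left
      have hℓodd : Odd (⟨ℓ, 2 * c, (c ^ 2 + p) / ℓ⟩ : BinQF).a := by
        show Odd (ℓ : ℤ)
        exact_mod_cast hℓ.odd_of_ne_two hℓ2
      obtain ⟨A', f, lam, hA', hf, hfA, hcardlam⟩ :=
        exists_factor_odd hp8 hp5 hA₀ hA₁ ψ hf₁ hℓodd hle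
      rw [← hSeq, hci, pow_one, hn] at hcardlam
      have hlt : Nat.card lam.toAddMonoidHom.ker < n := by
        have hc0 : 0 < Nat.card lam.toAddMonoidHom.ker := Nat.card_pos
        nlinarith [hℓ.one_lt]
      obtain ⟨f₂, hf₂, hf₂A⟩ := ih _ hlt hA' hA₁ lam rfl
      exact hcomp hf hfA hf₂ hf₂A
    · -- `#S = ℓ²`: `E[ℓ] ⊆ ker ψ`, strip `[ℓ]`
      have hSeq : S = geomTorsion (curve p A₀) ℓ :=
        AddSubgroup.eq_of_le_of_card_ge hSle (by rw [hcardE, hci])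
      have hle : geomTorsion (curve p A₀) ℓ ≤ ψ.toAddMonoidHom.ker := by
        rw [← hSeq]
        exact inf_le_left
      obtain ⟨lam, hlam⟩ := exists_factor_nsmul hp8 hA₀ hA₁ ψ hℓ hℓp hle
      rw [hn] at hlam
      have hlt : Nat.card lam.toAddMonoidHom.ker < n := by
        have hc0 : 0 < Nat.card lam.toAddMonoidHom.ker := Nat.card_pos
        have : 1 < ℓ ^ 2 := by nlinarith [hℓ.one_lt]
        nlinarith
      exact ih _ hlt hA₀ hA₁ lam rfl
  · -- `#ker ψ` is a power of `2`
    push Not at hodd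
    have hn2 : n = 2 ^ n.primeFactorsList.length :=
      Nat.eq_prime_pow_of_unique_prime_dvd hnpos.ne' fun {d} hd hdn ↦ by
        by_contra h
        exact hodd d hd h hdn
    by_cases he0 : n.primeFactorsList.length = 0
    · rw [he0, pow_zero] at hn2
      have hbot : ψ.toAddMonoidHom.ker = ⊥ := AddSubgroup.eq_bot_of_card_eq _ (by rw [hn, hn2])
      exact exists_label_of_ker_eq_bot hp8 hp5 hA₀ hA₁ ψ hbot
    · by_cases h2le : geomTorsion (curve p A₀) 2 ≤ ψ.toAddMonoidHom.ker
      · obtain ⟨lam, hlam⟩ := exists_factor_nsmul hp8 hA₀ hA₁ ψ Nat.prime_two (by omega) h2le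
        rw [hn] at hlam
        have hlt : Nat.card lam.toAddMonoidHom.ker < n := by
          have hc0 : 0 < Nat.card lam.toAddMonoidHom.ker := Nat.card_pos
          nlinarith
        exact ih _ hlt hA₀ hA₁ lam rfl
      · exact exists_label_of_card_ker_eq_two_pow hp8 hp5 hA₀ hA₁ ψ (Nat.pos_of_ne_zero he0)
          (hn.trans hn2) h2le

/-- **`csidh_classGroupAction` from the existence of `𝔽_p`-isogenies between valid curves.**
Clauses (1), (2) and the uniqueness half of (3) are theorems of the tree
(`csidh_classGroupAction_of_transitive`); transitivity is `exists_label_of_isogeny` applied to any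
`𝔽_p`-isogeny `E_{A₀} → E_{A₁}`. [cite: CastryckEtAl2018, §3 Thm. 7] -/
theorem csidh_classGroupAction_of_isogenous
    (hiso : ∀ (p : ℕ) [Fact p.Prime], p % 8 = 3 → 5 ≤ p → ∀ A₀ A₁ : ZMod p,
      IsCoeff p A₀ → IsCoeff p A₁ → (curve p A₀).IsIsogenous (curve p A₁)) :
    csidh_classGroupAction :=
  csidh_classGroupAction_of_transitive fun p _ hp8 hp5 A₀ A₁ h₀ h₁ ↦ by
    obtain ⟨ψ⟩ := hiso p hp8 hp5 A₀ A₁ h₀ h₁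
    exact exists_label_of_isogeny hp8 hp5 _ h₀ h₁ ψ rfl

/-- **`csidh_classGroupAction` from Tate's isogeny theorem in point-count form** (the tree's named
fact `Literature.AlgebraicGeometry.Motives.isIsogenous_iff_card_point_eq`, Tate 1966 Thm. 1(c),
for curves over `𝔽_p`): two valid curves both have `p + 1` rational points, hence are
`𝔽_p`-isogenous, and `csidh_classGroupAction_of_isogenous` applies. This is the last input of
CSIDH Thm. 7 ("`Ell_p(𝒪, π)` … whose `𝔽_p`-rational endomorphism ring … by [Tate's theorem]
these are the curves with `p + 1` points"). [cite: CastryckEtAl2018, §3 Thm. 7 and §4] -/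
theorem csidh_classGroupAction_of_isIsogenous_iff_card
    (htate : ∀ (p : ℕ) [Fact p.Prime] (W W' : WeierstrassCurve (ZMod p)),
      Literature.AlgebraicGeometry.Motives.isIsogenous_iff_card_point_eq (W := W) (W' := W')) :
    csidh_classGroupAction :=
  csidh_classGroupAction_of_isogenous fun p _ hp8 _ A₀ A₁ h₀ h₁ ↦ by
    haveI := isElliptic_of_isCoeff hp8 h₀
    haveI := isElliptic_of_isCoeff hp8 h₁
    exact (htate p (curve p A₀) (curve p A₁)).2 (by rw [h₀.2, h₁.2])

end Literature.Computability.Cryptography.Csidh
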